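import Summits.BirchSwinnertonDyer.BirchSwinnertonDyer.Theorems.InertBadSignedBranchesInertBadAtThreeQuarticModel
import Summits.BirchSwinnertonDyer.BirchSwinnertonDyer.Theorems.InertBadSignedBranchesInertBadAtThreeQuarticModelFourthPowerFree
import Summits.BirchSwinnertonDyer.BirchSwinnertonDyer.Theorems.InertBadSignedBranchesInertBadAtThreeOffIstarZeroQuarticFamily
import Literature.NumberTheory.EllipticCurves.SzpiroMinimalityProofs
import Literature.NumberTheory.EllipticCurves.ModularCurveManinSemistableCoprimeFormProofs
import Literature.NumberTheory.EllipticCurves.NeronLocalHeightCompletion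
import Literature.NumberTheory.EllipticCurves.ModularityVersionApProofs
import HarnessLib

/-!
# The FOURTH-POWER-FREE quartic model has a `3`-adic unit scaling, and its odd primes divide the conductor

Summit `BirchSwinnertonDyer`, crux `InertBadAtThree` (stmt-BirchSwinnertonDyer-19225), line of record `Lines/rubin_e1_inert_three.lean`
v5, registered stub `stub_plainOddNeronIntegralThreeQuartic`; STUB-PLAN `Cruxes/InertBadAtThree/STUB-PLAN-neronIntegralThreeQuartic-bsd-idea-18-g8.md`
(P1a / model lane). Width seat bsd-wall-cm-bed-w3 g8 (`--supports 19225`, helper). Joins bed-w2's P1a `…QuarticModelFourthPowerFree.stub_quarticModel`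
(p628412: `V = e • (y² = x³ − Dx)`, `D ≠ 0`, `3 ∣ D`, `D` fourth-power-free at EVERY prime) with the transport of `…QuarticModel`
(p628739: the `f`-free statements move along `C • V = model` when `3 ∤ den u_C`):

* `padicValRat_u_eq_zero_of_smul_eq_quartic` — for a GLOBALLY MINIMAL `V` and `C • V = ⟨0, 0, 0, A, 0⟩` with `3⁴ ∤ A`: `v₃(u_C) = 0`
  (the model is `3`-integral, so by minimality `v₃(Δ(V)) ≤ v₃(Δ(model)) = 3v₃(A) ≤ 9`, while `v₃(Δ(V)) = 12v₃(u_C) + 3v₃(A) ≥ 0`).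
* `exists_smul_eq_quartic_fourthPowerFree` — ★ every globally minimal `V` with `j = 1728` bad at `3` has a model `C • V = ⟨0,0,0,A,0⟩` with
  `A ≠ 0`, `3 ∣ A`, `p⁴ ∤ A` for every prime `p`, AND `v₃(u_C) = 0` (so `…QuarticModel.LValueOdd_of_smul` applies to it).
* `dvd_conductorNorm_of_prime_dvd_quartic` — for `C • V = ⟨0,0,0,A,0⟩`, an odd prime `p` with `p ∣ A`, `p⁴ ∤ A` divides `N_V` (the model is
  bad at `p`: bed-w2's exact Tate step `…InertBadOffQuarticFamily.not_hasGoodReductionAt_of_eq_quartic`; good reduction is an isomorphism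
  invariant, `hasGoodReductionAt_smul_iff_holds`; `dvd_conductorNorm_iff`). Hence for the fourth-power-free model a prime `ℓ ∤ N_V`, `ℓ ≠ 2`,
  does not divide `A` (`not_dvd_quartic_of_not_dvd_conductorNorm`) — the coprimality the theta dictionary (P1b) needs from the stub's `ℓ ∤ N_V`.

HONEST FRAMING: bookkeeping only; nothing here proves the stub, the crux or BSD. No definition, no named fact, no `sorry`; axioms standard.
-/

set_option autoImplicit false
set_option linter.dupNamespace false

noncomputable section

open WeierstrassCurve IsDedekindDomain NumberField Rat.HeightOneSpectrum
open Literature.NumberTheory.EllipticCurves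
open Summit.BirchSwinnertonDyer.Rank1Residual

namespace Summit.BirchSwinnertonDyer.BirchSwinnertonDyer.Theorems.InertBadSignedBranchesInertBadAtThreeQuarticModelUnit

open Summit.BirchSwinnertonDyer.BirchSwinnertonDyer.Theorems.InertBadSignedBranchesInertBadAtThreeQuarticModel (Δ_quartic)
open Summit.BirchSwinnertonDyer.BirchSwinnertonDyer.Theorems.InertBadSignedBranchesInertBadAtThreeQuarticModelFourthPowerFree
  (stub_quarticModel)
open Summit.BirchSwinnertonDyer.BirchSwinnertonDyer.Theorems.InertBadOffQuarticFamily
  (valuation_intCast_eq_exp_neg not_hasGoodReductionAt_of_eq_quartic)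

/-! ## §1 `v₃(u_C) = 0` for a `3`-fourth-power-free model of a globally minimal curve -/

/-- ★ **The scaling to a `3`-fourth-power-free quartic model is a `3`-adic unit.** For a globally minimal elliptic `V/ℚ` and `C` with
`C • V = ⟨0, 0, 0, A, 0⟩`, `A ∈ ℤ`, `3⁴ ∤ A`: `v₃(u_C) = 0`. [cite: SilvermanAEC2009, VII.1 Remark 1.1 and Prop. 1.3] -/
theorem padicValRat_u_eq_zero_of_smul_eq_quartic (V : WeierstrassCurve ℚ) [V.IsElliptic] [V.IsGloballyMinimal]
    {A : ℤ} {C : VariableChange ℚ} (hCV : C • V = ⟨0, 0, 0, (A : ℚ), 0⟩) (h4 : ¬ (3 : ℤ) ^ 4 ∣ A) :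
    padicValRat 3 (C.u : ℚ) = 0 := by
  haveI : Fact (Nat.Prime 3) := ⟨Nat.prime_three⟩
  have hA0 : A ≠ 0 := by
    intro hA
    have hΔ : (C • V).Δ ≠ 0 := (C • V).isUnit_Δ.ne_zero
    rw [hCV, Δ_quartic, hA] at hΔ
    norm_num at hΔ
  -- the place `v = (3)` of `ℤ`
  set v : HeightOneSpectrum ℤ := (Rat.HeightOneSpectrum.primesEquiv (R := ℤ)).symm ⟨3, Nat.prime_three⟩ with hvdef
  have hv : Rat.HeightOneSpectrum.natGenerator v = 3 :=
    congrArg Subtype.val ((Rat.HeightOneSpectrum.primesEquiv (R := ℤ)).apply_symm_apply ⟨3, Nat.prime_three⟩)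
  -- the model is integral at `3`, so `v₃(Δ(V)) ≤ v₃(Δ(model))`
  have hint : (C • V).IsIntegralAt v := by
    rw [hCV, show (⟨0, 0, 0, (A : ℚ), 0⟩ : WeierstrassCurve ℚ) = (⟨0, 0, 0, A, 0⟩ : WeierstrassCurve ℤ).baseChange ℚ by
      ext <;> simp [WeierstrassCurve.baseChange, WeierstrassCurve.map]]
    exact isIntegralAt_baseChange_int v _
  have hle := valuation_Δ_smul_le_of_isMinimalAt v (IsGloballyMinimal.isMinimalAt_int V v) C hint
  rw [hCV, Δ_quartic] at hle
  have hu0 : (C.u : ℚ) ≠ 0 := C.u.ne_zero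
  have hA0' : (A : ℚ) ≠ 0 := by exact_mod_cast hA0
  have hΔV : V.Δ = (C.u : ℚ) ^ 12 * (-64 * (A : ℚ) ^ 3) := by
    have h := congrArg WeierstrassCurve.Δ hCV
    rw [variableChange_Δ, Δ_quartic, Units.val_inv_eq_inv_val] at h
    field_simp at h
    linear_combination h
  have hΔV0 : V.Δ ≠ 0 := by
    rw [hΔV]; exact mul_ne_zero (pow_ne_zero _ hu0) (mul_ne_zero (by norm_num) (pow_ne_zero _ hA0'))
  have hΔA0 : (-64 * (A : ℚ) ^ 3) ≠ 0 := mul_ne_zero (by norm_num) (pow_ne_zero _ hA0')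
  rw [Rat.HeightOneSpectrum.valuation_eq_exp_neg_padicValRat v hΔA0,
    Rat.HeightOneSpectrum.valuation_eq_exp_neg_padicValRat v hΔV0, hv, WithZero.exp_le_exp, neg_le_neg_iff] at hle
  -- valuations
  have h64 : padicValRat 3 (-64 : ℚ) = 0 := by
    rw [padicValRat.neg, show (64 : ℚ) = ((64 : ℕ) : ℚ) by norm_num, padicValRat.of_nat]
    norm_num [padicValNat.eq_zero_of_not_dvd]
  have hvmod : padicValRat 3 (-64 * (A : ℚ) ^ 3) = 3 * padicValInt 3 A := by
    rw [padicValRat.mul (by norm_num) (pow_ne_zero _ hA0'), h64, padicValRat.pow (A : ℚ), padicValRat.of_int]; ring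
  have hvV : padicValRat 3 V.Δ = 12 * padicValRat 3 (C.u : ℚ) + 3 * padicValInt 3 A := by
    rw [hΔV, padicValRat.mul (pow_ne_zero _ hu0) hΔA0, padicValRat.pow (C.u : ℚ), hvmod]; ring
  -- `v₃(Δ(V)) ≥ 0` (an integer) and `v₃(A) ≤ 3`
  have hmin : (0 : ℤ) ≤ padicValRat 3 V.Δ := by
    rw [← cast_minimalDiscriminantInt V, padicValRat.of_int]; exact_mod_cast Nat.zero_le _
  have hk : padicValInt 3 A ≤ 3 := by
    by_contra h
    exact h4 (by exact_mod_cast (padicValInt_dvd_iff (p := 3) 4 A).mpr (Or.inr (by omega)))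
  rw [hvmod, hvV] at hle
  rw [hvV] at hmin
  have hk' : (padicValInt 3 A : ℤ) ≤ 3 := by exact_mod_cast hk
  have h1 : padicValRat 3 (C.u : ℚ) ≤ 0 := by linarith
  have h2 : -1 < padicValRat 3 (C.u : ℚ) := by linarith
  omega

/-- ★ **The fourth-power-free quartic model with `3`-adic unit scaling.** Every globally minimal elliptic `V/ℚ` with `j(V) = 1728` bad at `3`
has `C • V = ⟨0, 0, 0, A, 0⟩` with `A ∈ ℤ ∖ 0`, `3 ∣ A`, `p⁴ ∤ A` for every prime `p`, and `v₃(u_C) = 0` (bed-w2's P1a `stub_quarticModel` +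
`padicValRat_u_eq_zero_of_smul_eq_quartic`). [cite: SilvermanAEC2009, X.5.4 (iii) and VII.1 Remark 1.1] -/
theorem exists_smul_eq_quartic_fourthPowerFree (V : WeierstrassCurve ℚ) [V.IsElliptic] [V.IsGloballyMinimal]
    (hj : V.j = 1728) (hbad : ¬ V.HasGoodReductionAtPrime 3) :
    ∃ (A : ℤ) (C : VariableChange ℚ), C • V = ⟨0, 0, 0, (A : ℚ), 0⟩ ∧ A ≠ 0 ∧ (3 : ℤ) ∣ A ∧
      (∀ p : ℕ, p.Prime → ¬ ((p : ℤ) ^ 4 ∣ A)) ∧ padicValRat 3 (C.u : ℚ) = 0 := by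
  obtain ⟨D, e, hD0, h3D, h4, hV⟩ := stub_quarticModel V hj hbad
  have hCV : e⁻¹ • V = ⟨0, 0, 0, ((-D : ℤ) : ℚ), 0⟩ := by
    rw [hV, smul_smul, inv_mul_cancel, one_smul]; push_cast; rfl
  have h4' : ∀ p : ℕ, p.Prime → ¬ ((p : ℤ) ^ 4 ∣ -D) := fun p hp h ↦ h4 p hp (dvd_neg.mp h)
  exact ⟨-D, e⁻¹, hCV, neg_ne_zero.mpr hD0, (dvd_neg.mpr h3D), h4',
    padicValRat_u_eq_zero_of_smul_eq_quartic V hCV (h4' 3 Nat.prime_three)⟩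

/-! ## §2 The odd primes of the fourth-power-free model divide the conductor -/

/-- ★ **An odd prime `p` with `p ∣ A`, `p⁴ ∤ A` divides the conductor** of any elliptic `V` with a model `C • V = (y² = x³ + Ax)`: the model is
bad at `p` (`1 ≤ v_p(A) ≤ 3`, bed-w2's exact Tate step `not_hasGoodReductionAt_of_eq_quartic`), good reduction is an isomorphism invariant
(`hasGoodReductionAt_smul_iff_holds`), and `p ∣ N_V ⟺` bad at `p` (`dvd_conductorNorm_iff`).
[cite: SilvermanAEC2009, VII.1 Remark 1.1 and VII.5 Prop. 5.1(a)] -/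
theorem dvd_conductorNorm_of_prime_dvd_quartic (V : WeierstrassCurve ℚ) [V.IsElliptic]
    {A : ℤ} {C : VariableChange ℚ} (hCV : C • V = ⟨0, 0, 0, (A : ℚ), 0⟩)
    {p : ℕ} (hp : p.Prime) (hp2 : p ≠ 2) (hpA : (p : ℤ) ∣ A) (hp4 : ¬ (p : ℤ) ^ 4 ∣ A) :
    p ∣ V.conductorNorm ℤ := by
  haveI : Fact p.Prime := ⟨hp⟩
  have hA0 : A ≠ 0 := by rintro rfl; exact hp4 (dvd_zero _)
  -- the place of `𝓞 ℚ` over `p`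
  set v : HeightOneSpectrum (𝓞 ℚ) := (primesEquiv (R := 𝓞 ℚ)).symm ⟨p, hp⟩ with hvdef
  have hpv : primesEquiv v = ⟨p, hp⟩ := (primesEquiv (R := 𝓞 ℚ)).apply_symm_apply ⟨p, hp⟩
  have hv : natGenerator v = p := congrArg Subtype.val hpv
  -- `v_p(A) = s ∈ {1, 2, 3}`
  set s : ℕ := padicValInt p A with hs
  have hs1 : 1 ≤ s := by
    rcases (padicValInt_dvd_iff (p := p) 1 A).mp (by simpa using hpA) with h | h
    · exact absurd h hA0
    · exact h
  have hs3 : s ≤ 3 := by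
    by_contra h
    exact hp4 ((padicValInt_dvd_iff (p := p) 4 A).mpr (Or.inr (by omega)))
  have hps : (natGenerator v : ℤ) ^ s ∣ A := by rw [hv, hs]; exact padicValInt_dvd A
  have hps' : ¬ (natGenerator v : ℤ) ^ (s + 1) ∣ A := by
    rw [hv]
    intro h
    rcases (padicValInt_dvd_iff (p := p) (s + 1) A).mp h with h' | h'
    · exact hA0 h'
    · omega
  have ha : v.valuation ℚ ((A : ℤ) : ℚ) = WithZero.exp (-(s : ℤ)) := valuation_intCast_eq_exp_neg v hps hps'
  have hbad : ¬ (C • V).HasGoodReductionAt v :=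
    not_hasGoodReductionAt_of_eq_quartic (C • V) v (by rw [hv]; exact hp2) hCV hs1 hs3 ha
  rw [hasGoodReductionAt_smul_iff_holds v V C] at hbad
  have h := (V.dvd_conductorNorm_iff v).mpr hbad
  rwa [hpv] at h

/-- ★ **For the fourth-power-free model, a prime `ℓ ∤ N_V` with `ℓ ≠ 2` does not divide `A`** (the coprimality the theta dictionary needs from
the stub's hypothesis `ℓ ∤ N_V`). [cite: SilvermanAEC2009, VII.5 Prop. 5.1(a)] -/
theorem not_dvd_quartic_of_not_dvd_conductorNorm (V : WeierstrassCurve ℚ) [V.IsElliptic]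
    {A : ℤ} {C : VariableChange ℚ} (hCV : C • V = ⟨0, 0, 0, (A : ℚ), 0⟩)
    (h4 : ∀ p : ℕ, p.Prime → ¬ ((p : ℤ) ^ 4 ∣ A))
    {ℓ : ℕ} (hℓ : ℓ.Prime) (hℓ2 : ℓ ≠ 2) (hℓN : ¬ ℓ ∣ V.conductorNorm ℤ) : ¬ (ℓ : ℤ) ∣ A :=
  fun h ↦ hℓN (dvd_conductorNorm_of_prime_dvd_quartic V hCV hℓ hℓ2 h (h4 ℓ hℓ))

end Summit.BirchSwinnertonDyer.BirchSwinnertonDyer.Theorems.InertBadSignedBranchesInertBadAtThreeQuarticModelUnit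

end
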